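import Summits.ValiantsHypothesis.ValiantsHypothesis.Theorems.LacunarySymmetroidMatrixDescartesLagrangeTowerFrame

/-!
# `MatrixDescartes` census — arrowhead Lagrange tower: leading blocks, level determinants and the test-point walk

HONEST FRAMING.  Object-search cell `pub-symmetroid`, crux `Theses.LacunarySymmetroid.MatrixDescartes`
(stmt-ValiantsHypothesis-18050); seat val-sym-mdr-p1 (g2).  Part of the kernel port of the cell's THEOREM L (conjb-3 g3, ROUND3-MEMO §1;
paper-checked by conjb-1 g2 and theory g21) in the arrowhead / secular form of `…LagrangeTowerDefs`: for EVERY `m ≥ 1` some real symmetric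
three-term lacunary `m × m` pencil has `C(m+2,2) − 1` distinct positive determinant roots, so `KThreeColumnLaw` (CONJECTURE A3) holds.
This is a LOWER-bound / Descartes-extremality statement for the thin `K = 3` column (CONJECTURE-A currency); it proves nothing about
the crux `MatrixDescartes` (an upper-bound statement at fat formats) and nothing about `VP ≠ VNP`.  No definitions in this file.

THIS FILE. `tower_leading`: the leading `j × j` blocks of level `k ≥ j` ARE level `j`; `det_level`: `det(W)²·det(A + tB) = ∏ β_i (t − zroot j i)`
on a good level; the test points `spt` versus roots/thresholds (`spt_lt_zroot_iff`, `thr_lt_spt`, `spt_lt_thr`); the walk invariant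
(`walk_inv`: remaining steps `tri (j+1) − 1 − r = (tri (m+1) − 1) − n`), the two step types (`walk_step`) and monotonicity of the test
points (`pts_lt_succ`); `tri n = C(n+1,2)`. [folklore]
-/

-- `Summit.ValiantsHypothesis.ValiantsHypothesis.…` repeats a component by the D-0017 layout
-- (single-conjunct summit), which the `dupNamespace` linter flags; the name is mandated.
set_option linter.dupNamespace false

namespace Summit.ValiantsHypothesis.ValiantsHypothesis.Theorems.LacunarySymmetroidMatrixDescartes.Census.LagrangeTower

open Matrix Polynomial Finset
open scoped BigOperators

section Blocks

/-- Leading block of the bordered constant letter. -/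
theorem step_A_castSucc {k : ℕ} (d : TowerData k) (a b : Fin k) :
    (step d).A (Fin.castSucc a) (Fin.castSucc b) = d.A a b := by
  simp [step, Matrix.reindex_apply]

/-- Leading block of the bordered linear letter. -/
theorem step_B_castSucc {k : ℕ} (d : TowerData k) (a b : Fin k) :
    (step d).B (Fin.castSucc a) (Fin.castSucc b) = d.B a b := by
  simp [step, Matrix.reindex_apply]

/-- `Fin.castLE` into `Fin (k+1)` factors through `Fin.castSucc`. -/
theorem castLE_eq_castSucc_castLE {j k : ℕ} (h : j ≤ k + 1) (h' : j ≤ k) (a : Fin j) :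
    Fin.castLE h a = Fin.castSucc (Fin.castLE h' a) := Fin.ext rfl

/-- **Leading blocks of the tower are the lower levels**: for `j ≤ k`, the leading `j × j` blocks of `(A_k, B_k)` are
`(A_j, B_j)`. -/
theorem tower_leading : ∀ (k j : ℕ) (h : j ≤ k),
    ((tower k).A).submatrix (Fin.castLE h) (Fin.castLE h) = (tower j).A ∧
      ((tower k).B).submatrix (Fin.castLE h) (Fin.castLE h) = (tower j).B
  | 0, j, h => by
    obtain rfl : j = 0 := Nat.le_zero.mp h
    constructor <;> (ext a b; exact a.elim0)
  | k + 1, j, h => by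
    rcases Nat.lt_or_ge j (k + 1) with hlt | hge
    · have h' : j ≤ k := Nat.lt_succ_iff.mp hlt
      obtain ⟨ihA, ihB⟩ := tower_leading k j h'
      constructor
      · rw [← ihA]
        ext a b
        simp only [Matrix.submatrix_apply, castLE_eq_castSucc_castLE h h']
        exact step_A_castSucc (tower k) _ _
      · rw [← ihB]
        ext a b
        simp only [Matrix.submatrix_apply, castLE_eq_castSucc_castLE h h']
        exact step_B_castSucc (tower k) _ _
    · obtain rfl : j = k + 1 := le_antisymm h hge
      constructor <;>
      · ext a b
        rfl

/-- The leading `j × j` minor of level `k` at `t` is the determinant of level `j` at `t`. -/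
theorem pminor_eq (k j : ℕ) (h : j ≤ k) (t : ℝ) :
    pminor k j h t = Matrix.det ((tower j).A + t • (tower j).B) := by
  unfold pminor
  obtain ⟨hA, hB⟩ := tower_leading k j h
  simp only [Matrix.submatrix_add, Matrix.submatrix_smul, Pi.add_apply, Pi.smul_apply, hA, hB]

/-- `det W ≠ 0` on a good level. -/
theorem det_W_ne_zero {j : ℕ} (d : TowerData j) (hd : d.Good) : d.W.det ≠ 0 := by
  intro h
  have h1 := congrArg Matrix.det hd.2.1
  rw [Matrix.det_mul, Matrix.det_transpose, h, zero_mul, Matrix.det_one] at h1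
  exact zero_ne_one h1

/-- **Determinant of a good level**: `det(W)² · det(A + tB) = ∏_i β_i (t − zroot j i)`. -/
theorem det_level {j : ℕ} (d : TowerData j) (hd : d.Good) (t : ℝ) :
    d.W.det ^ 2 * Matrix.det (d.A + t • d.B) = ∏ i, d.β i * (t - zroot j i) := by
  have h := congrArg Matrix.det (hd.2.2.1 t)
  rw [Matrix.det_mul, Matrix.det_mul, Matrix.det_transpose, Matrix.det_diagonal] at h
  rw [← h]; ring

/-- Hence the SIGN of `det(A_j + t B_j)` is the sign of `∏_i β_i (t − zroot j i)`. -/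
theorem det_level_pos_iff {j : ℕ} (d : TowerData j) (hd : d.Good) (t : ℝ) :
    0 < Matrix.det (d.A + t • d.B) * ∏ i, d.β i * (t - zroot j i) ↔ ∏ i, d.β i * (t - zroot j i) ≠ 0 := by
  rw [← det_level d hd t]
  have hW : 0 < d.W.det ^ 2 := by
    have := det_W_ne_zero d hd
    positivity
  constructor
  · intro h hzero
    rw [mul_eq_zero] at hzero
    rcases hzero with h0 | h0
    · exact absurd h0 (ne_of_gt hW)
    · rw [h0, mul_zero, mul_zero] at h; exact lt_irrefl _ h
  · intro h
    have hdet : Matrix.det (d.A + t • d.B) ≠ 0 := by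
      intro h0; exact h (by rw [h0, mul_zero])
    have : Matrix.det (d.A + t • d.B) * (d.W.det ^ 2 * Matrix.det (d.A + t • d.B))
        = d.W.det ^ 2 * (Matrix.det (d.A + t • d.B)) ^ 2 := by ring
    rw [this]
    positivity

end Blocks

section Walk

/-! ### Test points versus roots and thresholds -/

/-- Test points are positive. -/
theorem spt_pos (k r : ℕ) : 0 < spt k r := by unfold spt; positivity

/-- `4^{-k} < spt k r`. -/
theorem spt_gt (k r : ℕ) : ((4 : ℝ)⁻¹) ^ k < spt k r := by
  unfold spt
  have h : 0 < (2 * (r : ℝ) + 1) / (2 * (k : ℝ) + 2) := by positivity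
  nlinarith [four_inv_pow_pos k]

/-- `spt k r < 2·4^{-k}` for `r ≤ k`. -/
theorem spt_lt (k r : ℕ) (hr : r ≤ k) : spt k r < 2 * ((4 : ℝ)⁻¹) ^ k := by
  unfold spt
  have hk : 0 < 2 * (k : ℝ) + 2 := by positivity
  have hr' : (r : ℝ) ≤ k := by exact_mod_cast hr
  have h : (2 * (r : ℝ) + 1) / (2 * (k : ℝ) + 2) < 1 := by rw [div_lt_one hk]; linarith
  nlinarith [four_inv_pow_pos k]

/-- Test points of one window increase with `r`. -/
theorem spt_strictMono_r (k : ℕ) {r r' : ℕ} (h : r < r') : spt k r < spt k r' := by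
  unfold spt
  have hk : 0 < 2 * (k : ℝ) + 2 := by positivity
  have h' : (r : ℝ) + 1 ≤ r' := by exact_mod_cast h
  apply mul_lt_mul_of_pos_left _ (four_inv_pow_pos k)
  have : (2 * (r : ℝ) + 1) / (2 * (k : ℝ) + 2) < (2 * (r' : ℝ) + 1) / (2 * (k : ℝ) + 2) :=
    div_lt_div_of_pos_right (by linarith) hk
  linarith

/-- Windows are ordered: every test point of window `k` (with `r ≤ k`) lies below every test point of window `k' < k`. -/
theorem spt_lt_spt_of_lt {k k' r r' : ℕ} (hk : k' < k) (hr : r ≤ k) : spt k r < spt k' r' := by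
  have h1 := spt_lt k r hr
  have h2 := spt_gt k' r'
  have h3 : 2 * ((4 : ℝ)⁻¹) ^ k ≤ ((4 : ℝ)⁻¹) ^ k' := by
    obtain ⟨e, rfl⟩ : ∃ e, k = k' + 1 + e := ⟨k - k' - 1, by omega⟩
    rw [pow_add, pow_add, pow_one]
    have : ((4 : ℝ)⁻¹) ^ e ≤ 1 := pow_le_one₀ (by norm_num) (by norm_num)
    have h4 := four_inv_pow_pos k'
    nlinarith
  linarith

/-- `spt k r < zroot k i ↔ r ≤ i`. -/
theorem spt_lt_zroot_iff (k r : ℕ) (i : Fin k) : spt k r < zroot k i ↔ r ≤ (i : ℕ) := by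
  unfold spt zroot
  have hk : 0 < (k : ℝ) + 1 := by positivity
  have h4 := four_inv_pow_pos k
  rw [mul_lt_mul_iff_right₀ h4, add_lt_add_iff_left]
  rw [show (2 * (k : ℝ) + 2) = 2 * ((k : ℝ) + 1) by ring, div_lt_div_iff₀ (by positivity) hk]
  constructor
  · intro h
    by_contra hc
    push Not at hc
    have : (i : ℝ) + 1 ≤ r := by exact_mod_cast hc
    nlinarith
  · intro h
    have : (r : ℝ) ≤ i := by exact_mod_cast h
    nlinarith

/-- `zroot k i < spt k r ↔ i < r`. -/
theorem zroot_lt_spt_iff (k r : ℕ) (i : Fin k) : zroot k i < spt k r ↔ (i : ℕ) < r := by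
  unfold spt zroot
  have hk : 0 < (k : ℝ) + 1 := by positivity
  have h4 := four_inv_pow_pos k
  rw [mul_lt_mul_iff_right₀ h4, add_lt_add_iff_left]
  rw [show (2 * (k : ℝ) + 2) = 2 * ((k : ℝ) + 1) by ring, div_lt_div_iff₀ hk (by positivity)]
  constructor
  · intro h
    by_contra hc
    push Not at hc
    have : (r : ℝ) ≤ i := by exact_mod_cast hc
    nlinarith
  · intro h
    have : (i : ℝ) + 1 ≤ r := by exact_mod_cast h
    nlinarith

/-- Thresholds are positive. -/
theorem thr_pos (a : ℕ) : 0 < thr a := by unfold thr; positivity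

/-- Coordinate `a` is ON at every point of window `k` when `k ≤ a`. -/
theorem thr_lt_spt {a k : ℕ} (h : k ≤ a) (r : ℕ) : thr a < spt k r := by
  have h2 := spt_gt k r
  unfold thr
  obtain ⟨e, rfl⟩ : ∃ e, a = k + e := ⟨a - k, by omega⟩
  rw [show k + e + 1 = k + (e + 1) by omega, pow_add]
  have : ((4 : ℝ)⁻¹) ^ (e + 1) ≤ 4⁻¹ := by
    rw [pow_succ]
    have : ((4 : ℝ)⁻¹) ^ e ≤ 1 := pow_le_one₀ (by norm_num) (by norm_num)
    nlinarith
  nlinarith [four_inv_pow_pos k]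

/-- Coordinate `a` is OFF at every point of window `k` when `a < k` (and `r ≤ k`). -/
theorem spt_lt_thr {a k : ℕ} (h : a < k) {r : ℕ} (hr : r ≤ k) : spt k r < thr a := by
  have h1 := spt_lt k r hr
  unfold thr
  obtain ⟨e, rfl⟩ : ∃ e, k = a + 1 + e := ⟨k - a - 1, by omega⟩
  rw [pow_add ((4 : ℝ)⁻¹) (a + 1) e] at h1
  have : ((4 : ℝ)⁻¹) ^ e ≤ 1 := pow_le_one₀ (by norm_num) (by norm_num)
  nlinarith [four_inv_pow_pos (a + 1)]

/-! ### The walk -/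

/-- `tri n = C(n+1, 2)`. -/
theorem tri_eq_choose : ∀ n : ℕ, tri n = Nat.choose (n + 1) 2
  | 0 => by simp [tri]
  | n + 1 => by
    rw [show tri (n + 1) = tri n + (n + 1) from rfl, tri_eq_choose n, Nat.choose_succ_succ (n + 1) 1,
      Nat.choose_one_right]
    ring

/-- The walk starts at the bottom test point of window `m`. -/
theorem walk_zero (m : ℕ) : walk m 0 = (m, 0) := rfl

/-- One step of the walk (definitional unfolding). -/
theorem walk_succ (m n : ℕ) :
    walk m (n + 1) = if (walk m n).2 < (walk m n).1 then ((walk m n).1, (walk m n).2 + 1)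
      else ((walk m n).1 - 1, 0) := rfl

/-- Walk invariant: for `n ≤ tri (m+1) − 1` the state `(j, r)` satisfies `r ≤ j ≤ m` and the number of remaining steps is
`tri (j+1) − 1 − r = (tri (m+1) − 1) − n`. -/
theorem walk_inv (m : ℕ) : ∀ n : ℕ, n ≤ tri (m + 1) - 1 →
    (walk m n).2 ≤ (walk m n).1 ∧ (walk m n).1 ≤ m ∧
      tri ((walk m n).1 + 1) - 1 - (walk m n).2 + n = tri (m + 1) - 1
  | 0, _ => by simp [walk_zero]
  | n + 1, hn => by
    obtain ⟨h1, h2, h3⟩ := walk_inv m n (by omega)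
    rw [walk_succ]
    have htri : tri ((walk m n).1 + 1) = tri (walk m n).1 + ((walk m n).1 + 1) := rfl
    by_cases hlt : (walk m n).2 < (walk m n).1
    · rw [if_pos hlt]
      refine ⟨hlt, h2, ?_⟩
      simp only
      omega
    · rw [if_neg hlt]
      have heq : (walk m n).2 = (walk m n).1 := le_antisymm h1 (not_lt.mp hlt)
      -- the state is not `(0,0)` since steps remain
      have hj : 1 ≤ (walk m n).1 := by
        by_contra h0
        have h0' : (walk m n).1 = 0 := by omega
        rw [h0', heq, h0', show tri (0 + 1) = 1 from rfl] at h3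
        omega
      refine ⟨Nat.zero_le _, by simp only; omega, ?_⟩
      simp only
      have htri' : tri ((walk m n).1 - 1 + 1) = tri ((walk m n).1 - 1) + ((walk m n).1 - 1 + 1) := rfl
      rw [show (walk m n).1 - 1 + 1 = (walk m n).1 by omega] at htri'
      rw [show (walk m n).1 - 1 + 1 = (walk m n).1 by omega]
      rw [heq] at h3
      omega

/-- The two kinds of steps, for `n < tri (m+1) − 1`. -/
theorem walk_step (m n : ℕ) (hn : n < tri (m + 1) - 1) :
    ((walk m n).2 < (walk m n).1 ∧ walk m (n + 1) = ((walk m n).1, (walk m n).2 + 1)) ∨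
    ((walk m n).2 = (walk m n).1 ∧ 1 ≤ (walk m n).1 ∧ walk m (n + 1) = ((walk m n).1 - 1, 0)) := by
  obtain ⟨h1, h2, h3⟩ := walk_inv m n hn.le
  rw [walk_succ]
  by_cases hlt : (walk m n).2 < (walk m n).1
  · exact Or.inl ⟨hlt, by rw [if_pos hlt]⟩
  · right
    have heq : (walk m n).2 = (walk m n).1 := le_antisymm h1 (not_lt.mp hlt)
    have hj : 1 ≤ (walk m n).1 := by
      by_contra h0
      have h0' : (walk m n).1 = 0 := by omega
      rw [h0', heq, h0', show tri (0 + 1) = 1 from rfl] at h3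
      omega
    exact ⟨heq, hj, by rw [if_neg hlt]⟩

/-- The walk's test points are positive. -/
theorem pts_pos (m n : ℕ) : 0 < pts m n := spt_pos _ _

/-- The test points increase along the walk. -/
theorem pts_lt_succ (m n : ℕ) (hn : n < tri (m + 1) - 1) : pts m n < pts m (n + 1) := by
  unfold pts
  rcases walk_step m n hn with ⟨hlt, hw⟩ | ⟨heq, hj, hw⟩
  · rw [hw]; exact spt_strictMono_r _ (Nat.lt_succ_self _)
  · rw [hw]
    simp only
    exact spt_lt_spt_of_lt (by omega) (by omega)

end Walk

end Summit.ValiantsHypothesis.ValiantsHypothesis.Theorems.LacunarySymmetroidMatrixDescartes.Census.LagrangeTower
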